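import Mathlib
import HarnessLib

/-!
# Route `KLProgramme`, crux K3 `KLRegimeTwoPointLimit`, child 4 `KLRegimeTwoPointAssembly`, stub `stub_asm_matsubara` —
# part A: the CLUSTER-INTEGRAL BOUND (time integration of products of single sums of a small kernel)

Cell gate-hubbard-kl, seat t2 (HOME/t2/MATSUBARA-ALLU-SCOPE.md §2 (e)–(f)).  In the all-coupling Matsubara-UV identification of
the Hubbard Grassmann representation (the tree's `tendsto_grassmannTwoPoint_eq_hubbardThermalTwoPoint_sub` WITHOUT its
smallness hypothesis) the Wick matrix of the sharply truncated covariance is split into the untruncated time-ordered kernel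
plus a remainder whose rows enter the determinant bound only through `ℓ²` row norms; after squaring, every interaction
vertex `a` carries ONE single sum `Σ_b w(τ_b − τ_a)` of a kernel `w ≥ 0` that is uniformly bounded (`w ≤ K`) and small in
`L¹` (`∫₀^β w(c − t) dt ≤ ε` for every `c`).  This file bounds the time integrals of products of such sums:

* `lintegral_update_prod_sum_le` — integrating ONE vertex time `τ_i` (`i ∈ S`): the factor of `i` has integral
  `≤ βK + mε`, every other factor contains exactly one `τ_i`-dependent term `w(τ_i − τ_a) ≤ K`, and expanding the product
  of the other factors binomially in these terms (`Finset.prod_add`) gives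
  `∫ dτ_i ∏_{a∈S} Σ_b w ≤ (βK + mε) Σ_{T ⊆ S∖i} K^{|T|} ∏_{a ∈ S∖i∖T} Σ_b w`;
* **`lmarginal_prod_sum_le`** — hence, by induction (Mathlib's iterated marginals `MeasureTheory.lmarginal`),
  `∫⋯∫_{V} ∏_{a∈S} Σ_b w(τ_b − τ_a) dτ_V ≤ β^{|V|−|S|} · A_{|S|}` for EVERY sequence `A` with `A₀ ≥ 1` and
  `(βK + mε) Σ_{t≤s} C(s,t) (βK)^t A_{s−t} ≤ A_{s+1}` (a Touchard/Bell-type recursion; `A` is a hypothesis, no definition);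
* `touchard_step`, `touchard_total` — the explicit majorant `A_s = s! r^{−s} Σ_{j≤s} y^j/j!`, `y = (βK+mε)·r·e^{βKr}`, satisfies
  the recursion for EVERY `r > 0`, and `Σ_t C(m,t) β^{m−t} A_t ≤ m!·r^{−m}·e^{βr}·e^{y}`;
* **`integral_sum_prod_sum_le`** — the packaged real-variable statement on the time cube `[0,β]^m`:
  `∫_{[0,β]^m} Σ_{T ⊆ [m]} ∏_{a∈T} Σ_b w(τ_b − τ_a) dτ ≤ m!·r^{−m}·e^{βr}·exp((βK+mε) r e^{βKr})` for every `r > 0`.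

Dividing by `m!` and choosing `r` proportional to the coupling, the right-hand side is a geometric sequence in `m` whose
ratio tends to `e^{0} ·(const/r)` as `ε → 0` — this is what removes the radius `3e|U|L²βB² < 1` of the tree's bridge.
Pure measure theory and elementary combinatorics; nothing about the model is used here.
-/

namespace Summit.HubbardSuperconductivity.HubbardSuperconductivity.Theorems.MatsubaraAllU

set_option linter.dupNamespace false -- summit = problem name (single-conjunct summit), D-0017

open MeasureTheory Finset
open scoped ENNReal Nat

noncomputable section

/-! ### Iterated marginals: three bookkeeping lemmas -/

section Marginal

variable {δ : Type*} [DecidableEq δ] {X : δ → Type*} [∀ i, MeasurableSpace (X i)]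
  {μ : ∀ i, Measure (X i)}

/-- Constants come out of an iterated marginal. -/
theorem lmarginal_const_mul' (s : Finset δ) (c : ℝ≥0∞) {f : (∀ i, X i) → ℝ≥0∞} (hf : Measurable f)
    (x : ∀ i, X i) :
    (∫⋯∫⁻_s, (fun y => c * f y) ∂μ) x = c * (∫⋯∫⁻_s, f ∂μ) x := by
  unfold lmarginal
  exact lintegral_const_mul c (hf.comp measurable_updateFinset)

/-- Finite sums come out of an iterated marginal. -/
theorem lmarginal_finset_sum' {ι : Type*} (s : Finset δ) (T : Finset ι) {f : ι → (∀ i, X i) → ℝ≥0∞}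
    (hf : ∀ t ∈ T, Measurable (f t)) (x : ∀ i, X i) :
    (∫⋯∫⁻_s, (fun y => ∑ t ∈ T, f t y) ∂μ) x = ∑ t ∈ T, (∫⋯∫⁻_s, f t ∂μ) x := by
  unfold lmarginal
  exact lintegral_finsetSum T fun t ht => (hf t ht).comp measurable_updateFinset

/-- The iterated marginal of a constant over the coordinates in `s`, each carrying Lebesgue measure restricted to
`[0, β]`, is the constant times `β^{|s|}`. -/
theorem lmarginal_const_restrict_Icc {m : ℕ} (β : ℝ) (s : Finset (Fin m)) (c : ℝ≥0∞) (x : Fin m → ℝ) :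
    (∫⋯∫⁻_s, (fun _ => c) ∂(fun _ : Fin m => (volume.restrict (Set.Icc (0 : ℝ) β)))) x =
      c * ENNReal.ofReal β ^ s.card := by
  unfold lmarginal
  rw [lintegral_const, Measure.pi_univ]
  simp only [Measure.restrict_apply_univ, Real.volume_Icc, sub_zero, Finset.prod_const, Finset.card_univ,
    Fintype.card_coe]

end Marginal

/-! ### The one-variable step and the recursion -/

section Cluster

variable {m : ℕ}

/-- The cluster integrand `τ ↦ ∏_{a∈S} Σ_b w(τ_b − τ_a)` is measurable. -/
theorem measurable_prod_sum_kernel (w : ℝ → ℝ≥0∞) (hw : Measurable w) (S : Finset (Fin m)) :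
    Measurable fun τ : Fin m → ℝ => ∏ a ∈ S, ∑ b : Fin m, w (τ b - τ a) := by
  refine Finset.measurable_prod S fun a _ => Finset.measurable_sum _ fun b _ => ?_
  exact hw.comp ((measurable_pi_apply b).sub (measurable_pi_apply a))

/-- **One integration.**  For `i ∈ S` and any base point `y`,
`∫₀^β dt ∏_{a∈S} Σ_b w((y[i↦t])_b − (y[i↦t])_a) ≤ (βK + mε) · Σ_{T ⊆ S∖i} K^{|T|} ∏_{a∈S∖i∖T} Σ_b w(y_b − y_a)`:
the factor of `i` integrates to at most `β w(0) + Σ_{b≠i} ∫₀^β w(y_b − t)dt ≤ βK + mε`, and the other factors are expanded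
binomially in their single `t`-dependent term `w(t − y_a) ≤ K`. -/
theorem lintegral_update_prod_sum_le (β : ℝ) (w : ℝ → ℝ≥0∞) (hw : Measurable w) (K ε : ℝ≥0∞)
    (hK : ∀ s, w s ≤ K) (hε : ∀ c : ℝ, ∫⁻ t in Set.Icc (0 : ℝ) β, w (c - t) ≤ ε)
    (S : Finset (Fin m)) {i : Fin m} (hi : i ∈ S) (y : Fin m → ℝ) :
    ∫⁻ t in Set.Icc (0 : ℝ) β, (∏ a ∈ S, ∑ b : Fin m, w (Function.update y i t b - Function.update y i t a)) ≤
      (ENNReal.ofReal β * K + m * ε) * ∑ T ∈ (S.erase i).powerset, K ^ T.card *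
        ∏ a ∈ (S.erase i) \ T, ∑ b : Fin m, w (y b - y a) := by
  classical
  -- the factor of `i` and its integral
  set g : ℝ → ℝ≥0∞ := fun t => w 0 + ∑ b ∈ univ.erase i, w (y b - t) with hg
  have hg_meas : Measurable g := by
    refine Measurable.add measurable_const (Finset.measurable_sum _ fun b _ => ?_)
    exact hw.comp (measurable_const.sub measurable_id)
  have hgi : ∀ t, ∑ b : Fin m, w (Function.update y i t b - Function.update y i t i) = g t := by
    intro t
    rw [← Finset.add_sum_erase univ _ (mem_univ i), Function.update_self, sub_self]
    refine congrArg _ (Finset.sum_congr rfl fun b hb => ?_)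
    rw [Function.update_of_ne (ne_of_mem_erase hb)]
  have hg_int : ∫⁻ t in Set.Icc (0 : ℝ) β, g t ≤ ENNReal.ofReal β * K + m * ε := by
    rw [hg, lintegral_add_left' aemeasurable_const, lintegral_const,
      lintegral_finsetSum _ fun b _ =>
        (show Measurable (fun t : ℝ => w (y b - t)) from hw.comp (measurable_const.sub measurable_id))]
    simp only [Measure.restrict_apply_univ, Real.volume_Icc, sub_zero]
    refine add_le_add ?_ ?_
    · rw [mul_comm]
      gcongr
      exact hK 0
    · calc ∑ b ∈ univ.erase i, ∫⁻ t in Set.Icc (0 : ℝ) β, w (y b - t)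
          ≤ ∑ _b ∈ univ.erase i, ε := Finset.sum_le_sum fun b _ => hε (y b)
        _ = ((univ.erase i).card : ℝ≥0∞) * ε := by rw [Finset.sum_const, nsmul_eq_mul]
        _ ≤ (m : ℝ≥0∞) * ε := by
            gcongr
            exact_mod_cast (Finset.card_le_univ _).trans_eq (Fintype.card_fin m)
  -- the other factors: `P a + Q a t`
  set P : Fin m → ℝ≥0∞ := fun a => ∑ b ∈ univ.erase i, w (y b - y a) with hP
  set Q : Fin m → ℝ → ℝ≥0∞ := fun a t => w (t - y a) with hQ
  have hother : ∀ t, ∀ a ∈ S.erase i,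
      ∑ b : Fin m, w (Function.update y i t b - Function.update y i t a) = Q a t + P a := by
    intro t a ha
    have hai : a ≠ i := ne_of_mem_erase ha
    rw [Function.update_of_ne hai, ← Finset.add_sum_erase univ _ (mem_univ i), Function.update_self]
    refine congrArg _ (Finset.sum_congr rfl fun b hb => ?_)
    rw [Function.update_of_ne (ne_of_mem_erase hb)]
  have hP_le : ∀ a, P a ≤ ∑ b : Fin m, w (y b - y a) := fun a =>
    Finset.sum_le_sum_of_subset_of_nonneg (erase_subset _ _) fun _ _ _ => zero_le
  -- pointwise bound of the integrand
  have hpt : ∀ t, (∏ a ∈ S, ∑ b : Fin m, w (Function.update y i t b - Function.update y i t a)) ≤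
      g t * ∑ T ∈ (S.erase i).powerset, K ^ T.card * ∏ a ∈ (S.erase i) \ T, ∑ b : Fin m, w (y b - y a) := by
    intro t
    rw [← Finset.mul_prod_erase S _ hi, hgi t, Finset.prod_congr rfl (hother t), Finset.prod_add]
    gcongr with T hT
    · exact Finset.prod_le_pow_card _ _ _ fun a _ => hK _
    · exact hP_le _
  calc ∫⁻ t in Set.Icc (0 : ℝ) β, (∏ a ∈ S, ∑ b : Fin m, w (Function.update y i t b - Function.update y i t a))
      ≤ ∫⁻ t in Set.Icc (0 : ℝ) β, g t * ∑ T ∈ (S.erase i).powerset, K ^ T.card *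
          ∏ a ∈ (S.erase i) \ T, ∑ b : Fin m, w (y b - y a) := lintegral_mono fun t => hpt t
    _ = (∫⁻ t in Set.Icc (0 : ℝ) β, g t) * ∑ T ∈ (S.erase i).powerset, K ^ T.card *
          ∏ a ∈ (S.erase i) \ T, ∑ b : Fin m, w (y b - y a) := lintegral_mul_const _ hg_meas
    _ ≤ _ := mul_le_mul_left hg_int _

/-- **The cluster-integral bound.**  Let `w ≥ 0` be measurable with `w ≤ K` and `∫₀^β w(c − t) dt ≤ ε` for every real `c`,
and let `A : ℕ → ℝ≥0∞` satisfy `A 0 ≥ 1` and the Touchard-type recursion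
`(βK + mε) Σ_{t ≤ s} C(s,t) (βK)^t A(s−t) ≤ A(s+1)`.  Then for all `S ⊆ V ⊆ [m]` and every base point `x`,
`∫⋯∫_{V} ∏_{a∈S} Σ_{b∈[m]} w(τ_b − τ_a) dτ_V ≤ β^{|V|−|S|} · A_{|S|}`
(coordinates in `V` integrated over `[0,β]`, the others frozen at `x`). -/
theorem lmarginal_prod_sum_le (β : ℝ) (w : ℝ → ℝ≥0∞) (hw : Measurable w) (K ε : ℝ≥0∞)
    (hK : ∀ s, w s ≤ K) (hε : ∀ c : ℝ, ∫⁻ t in Set.Icc (0 : ℝ) β, w (c - t) ≤ ε)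
    (A : ℕ → ℝ≥0∞) (hA0 : 1 ≤ A 0)
    (hA : ∀ s : ℕ, (ENNReal.ofReal β * K + m * ε) *
      ∑ t ∈ range (s + 1), ((s.choose t : ℕ) : ℝ≥0∞) * (ENNReal.ofReal β * K) ^ t * A (s - t) ≤ A (s + 1))
    (V S : Finset (Fin m)) (hSV : S ⊆ V) (x : Fin m → ℝ) :
    (∫⋯∫⁻_V, (fun τ => ∏ a ∈ S, ∑ b : Fin m, w (τ b - τ a))
        ∂(fun _ : Fin m => (volume.restrict (Set.Icc (0 : ℝ) β)))) x ≤
      ENNReal.ofReal β ^ (V.card - S.card) * A S.card := by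
  classical
  -- strong induction on `|S|`, everything else universally quantified
  suffices h : ∀ (k : ℕ) (S V : Finset (Fin m)) (x : Fin m → ℝ), S.card = k → S ⊆ V →
      (∫⋯∫⁻_V, (fun τ => ∏ a ∈ S, ∑ b : Fin m, w (τ b - τ a))
        ∂(fun _ : Fin m => (volume.restrict (Set.Icc (0 : ℝ) β)))) x ≤
      ENNReal.ofReal β ^ (V.card - S.card) * A S.card from h _ S V x rfl hSV
  intro k
  induction k using Nat.strong_induction_on with
  | _ k ih =>
    intro S V x hk hSV
    rcases S.eq_empty_or_nonempty with hS | hS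
    · -- no vertex factor: the integral of `1`
      subst hS
      simp only [Finset.prod_empty, Finset.card_empty, Nat.sub_zero]
      rw [lmarginal_const_restrict_Icc, one_mul]
      exact le_mul_of_one_le_right zero_le hA0
    · obtain ⟨i, hi⟩ := hS
      have hiV : i ∈ V := hSV hi
      have hmeas := measurable_prod_sum_kernel w hw S
      rw [lmarginal_erase' _ hmeas hiV]
      -- bound the inner integral pointwise, then use linearity and the induction hypothesis
      have hinner : ∀ y : Fin m → ℝ,
          (∫⁻ t, (∏ a ∈ S, ∑ b : Fin m, w (Function.update y i t b - Function.update y i t a))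
            ∂(volume.restrict (Set.Icc (0 : ℝ) β))) ≤
          (ENNReal.ofReal β * K + m * ε) * ∑ T ∈ (S.erase i).powerset, K ^ T.card *
            ∏ a ∈ (S.erase i) \ T, ∑ b : Fin m, w (y b - y a) := fun y =>
        lintegral_update_prod_sum_le β w hw K ε hK hε S hi y
      have hmeasT : ∀ T ∈ (S.erase i).powerset, Measurable fun y : Fin m → ℝ =>
          K ^ T.card * ∏ a ∈ (S.erase i) \ T, ∑ b : Fin m, w (y b - y a) := fun T _ =>
        (measurable_prod_sum_kernel w hw _).const_mul _
      calc (∫⋯∫⁻_V.erase i, (fun y => ∫⁻ t, (∏ a ∈ S, ∑ b : Fin m,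
              w (Function.update y i t b - Function.update y i t a)) ∂(volume.restrict (Set.Icc (0 : ℝ) β)))
              ∂(fun _ : Fin m => (volume.restrict (Set.Icc (0 : ℝ) β)))) x
          ≤ (∫⋯∫⁻_V.erase i, (fun y => (ENNReal.ofReal β * K + m * ε) *
              ∑ T ∈ (S.erase i).powerset, K ^ T.card * ∏ a ∈ (S.erase i) \ T, ∑ b : Fin m, w (y b - y a))
              ∂(fun _ : Fin m => (volume.restrict (Set.Icc (0 : ℝ) β)))) x := lmarginal_mono hinner x
        _ = (ENNReal.ofReal β * K + m * ε) * ∑ T ∈ (S.erase i).powerset, K ^ T.card *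
              (∫⋯∫⁻_V.erase i, (fun y => ∏ a ∈ (S.erase i) \ T, ∑ b : Fin m, w (y b - y a))
                ∂(fun _ : Fin m => (volume.restrict (Set.Icc (0 : ℝ) β)))) x := by
            rw [lmarginal_const_mul' _ _ (Finset.measurable_sum _ hmeasT), lmarginal_finset_sum' _ _ hmeasT]
            congr 1
            refine Finset.sum_congr rfl fun T _ => ?_
            rw [lmarginal_const_mul' _ _ (measurable_prod_sum_kernel w hw _)]
        _ ≤ (ENNReal.ofReal β * K + m * ε) * ∑ T ∈ (S.erase i).powerset, K ^ T.card *
              (ENNReal.ofReal β ^ ((V.erase i).card - ((S.erase i) \ T).card) * A ((S.erase i) \ T).card) := by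
            gcongr with T hT
            refine ih _ ?_ _ _ x rfl ?_
            · rw [← hk, Finset.card_sdiff_of_subset (mem_powerset.mp hT)]
              have := Finset.card_erase_lt_of_mem hi
              omega
            · exact (sdiff_subset).trans (Finset.erase_subset_erase i hSV)
        _ = ENNReal.ofReal β ^ (V.card - S.card) * ((ENNReal.ofReal β * K + m * ε) *
              ∑ T ∈ (S.erase i).powerset, ((ENNReal.ofReal β * K) ^ T.card * A ((S.erase i).card - T.card))) := by
            rw [Finset.mul_sum, Finset.mul_sum, Finset.mul_sum]
            refine Finset.sum_congr rfl fun T hT => ?_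
            have hTS : T ⊆ S.erase i := mem_powerset.mp hT
            have hcT : T.card ≤ (S.erase i).card := card_le_card hTS
            have hcS : (S.erase i).card + 1 = S.card := Finset.card_erase_add_one hi
            have hcV : (V.erase i).card + 1 = V.card := Finset.card_erase_add_one hiV
            have hSV' : S.card ≤ V.card := card_le_card hSV
            rw [Finset.card_sdiff_of_subset hTS,
              show (V.erase i).card - ((S.erase i).card - T.card) = (V.card - S.card) + T.card by omega,
              pow_add, mul_pow]
            ring
        _ ≤ ENNReal.ofReal β ^ (V.card - S.card) * A S.card := by
            gcongr
            rw [Finset.sum_powerset_apply_card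
              (fun t => (ENNReal.ofReal β * K) ^ t * A ((S.erase i).card - t))]
            simp only [nsmul_eq_mul, ← mul_assoc]
            rw [← Finset.card_erase_add_one hi]
            exact hA _

end Cluster

/-! ### The explicit Touchard-type majorant -/

section Touchard

/-- **The majorant satisfies the recursion.**  For `c, b ≥ 0`, `r > 0` and `y = c·r·e^{br}`, the sequence
`A_s = s!·r^{-s}·Σ_{j≤s} y^j/j!` obeys `c · Σ_{t≤s} C(s,t) b^t A_{s−t} ≤ A_{s+1}`:
`C(s,t)(s−t)! = s!/t!`, `Σ_t (br)^t/t! ≤ e^{br}`, and `E_s · y ≤ (s+1) · E_{s+1}` for the partial exponential sums `E_s`. -/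
theorem touchard_step (c b r : ℝ) (hc : 0 ≤ c) (hb : 0 ≤ b) (hr : 0 < r) (s : ℕ) :
    c * ∑ t ∈ range (s + 1), (s.choose t : ℝ) * b ^ t *
        (((s - t)! : ℝ) / r ^ (s - t) * ∑ j ∈ range (s - t + 1), (c * r * Real.exp (b * r)) ^ j / (j ! : ℝ)) ≤
      ((s + 1)! : ℝ) / r ^ (s + 1) * ∑ j ∈ range (s + 1 + 1), (c * r * Real.exp (b * r)) ^ j / (j ! : ℝ) := by
  set y : ℝ := c * r * Real.exp (b * r) with hy
  have hy0 : 0 ≤ y := by positivity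
  set E : ℕ → ℝ := fun n => ∑ j ∈ range (n + 1), y ^ j / (j ! : ℝ) with hE
  have hE_mono : ∀ {n n' : ℕ}, n ≤ n' → E n ≤ E n' := fun {n n'} h =>
    Finset.sum_le_sum_of_subset_of_nonneg (range_mono (by omega)) fun _ _ _ => by positivity
  have hE0 : ∀ n, 0 ≤ E n := fun n => Finset.sum_nonneg fun _ _ => by positivity
  -- `E_s · y ≤ (s+1) · E_{s+1}`
  have hEy : E s * y ≤ ((s : ℝ) + 1) * E (s + 1) := by
    show (∑ j ∈ range (s + 1), y ^ j / (j ! : ℝ)) * y ≤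
      ((s : ℝ) + 1) * ∑ j ∈ range (s + 1 + 1), y ^ j / (j ! : ℝ)
    rw [Finset.sum_range_succ' (fun j => y ^ j / (j ! : ℝ)) (s + 1), mul_add, Finset.sum_mul,
      Finset.mul_sum]
    have hlast : (0 : ℝ) ≤ ((s : ℝ) + 1) * (y ^ 0 / ((0 : ℕ) ! : ℝ)) := by positivity
    refine le_trans (Finset.sum_le_sum fun j hj => ?_) (le_add_of_nonneg_right hlast)
    have hj : j ≤ s := Nat.lt_succ_iff.mp (mem_range.mp hj)
    have hj1 : (0 : ℝ) < ((j + 1 : ℕ) : ℝ) := by exact_mod_cast Nat.succ_pos j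
    have hq : (1 : ℝ) ≤ ((s : ℝ) + 1) / ((j + 1 : ℕ) : ℝ) := by
      rw [le_div_iff₀ hj1, one_mul]
      exact_mod_cast Nat.succ_le_succ hj
    have hnn : 0 ≤ y ^ j * y / (j ! : ℝ) := by positivity
    calc y ^ j / (j ! : ℝ) * y = 1 * (y ^ j * y / (j ! : ℝ)) := by ring
      _ ≤ ((s : ℝ) + 1) / ((j + 1 : ℕ) : ℝ) * (y ^ j * y / (j ! : ℝ)) :=
          mul_le_mul_of_nonneg_right hq hnn
      _ = ((s : ℝ) + 1) * (y ^ (j + 1) / ((j + 1)! : ℝ)) := by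
          rw [Nat.factorial_succ, Nat.cast_mul, pow_succ]
          field_simp
  -- each term: `C(s,t) b^t (s-t)!/r^{s-t} E_{s-t} ≤ s!/r^s · E_s · (br)^t/t!`
  have hterm : ∀ t ∈ range (s + 1), (s.choose t : ℝ) * b ^ t * (((s - t)! : ℝ) / r ^ (s - t) * E (s - t)) ≤
      (s ! : ℝ) / r ^ s * E s * ((b * r) ^ t / (t ! : ℝ)) := by
    intro t ht
    have hts : t ≤ s := Nat.lt_succ_iff.mp (mem_range.mp ht)
    have hchoose : (s.choose t : ℝ) * ((s - t)! : ℝ) = (s ! : ℝ) / (t ! : ℝ) := by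
      rw [eq_div_iff (by exact_mod_cast (Nat.factorial_pos t).ne')]
      have := Nat.choose_mul_factorial_mul_factorial hts
      calc (s.choose t : ℝ) * ((s - t)! : ℝ) * (t ! : ℝ) = ((s.choose t * t ! * (s - t)! : ℕ) : ℝ) := by
            push_cast; ring
        _ = (s ! : ℝ) := by rw [this]
    have hrpow : r ^ (s - t) * r ^ t = r ^ s := pow_sub_mul_pow r hts
    calc (s.choose t : ℝ) * b ^ t * (((s - t)! : ℝ) / r ^ (s - t) * E (s - t))
        = (s.choose t : ℝ) * ((s - t)! : ℝ) * b ^ t / r ^ (s - t) * E (s - t) := by ring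
      _ = (s ! : ℝ) / (t ! : ℝ) * b ^ t / r ^ (s - t) * E (s - t) := by rw [hchoose]
      _ ≤ (s ! : ℝ) / (t ! : ℝ) * b ^ t / r ^ (s - t) * E s :=
          mul_le_mul_of_nonneg_left (hE_mono (Nat.sub_le s t)) (by positivity)
      _ = (s ! : ℝ) / r ^ s * E s * ((b * r) ^ t / (t ! : ℝ)) := by
          rw [mul_pow, ← hrpow]
          field_simp
  have hX0 : 0 ≤ (s ! : ℝ) / r ^ s * E s := mul_nonneg (by positivity) (hE0 s)
  calc c * ∑ t ∈ range (s + 1), (s.choose t : ℝ) * b ^ t * (((s - t)! : ℝ) / r ^ (s - t) * E (s - t))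
      ≤ c * ∑ t ∈ range (s + 1), (s ! : ℝ) / r ^ s * E s * ((b * r) ^ t / (t ! : ℝ)) :=
        mul_le_mul_of_nonneg_left (Finset.sum_le_sum hterm) hc
    _ = c * ((s ! : ℝ) / r ^ s * E s) * ∑ t ∈ range (s + 1), (b * r) ^ t / (t ! : ℝ) := by
        rw [← Finset.mul_sum]; ring
    _ ≤ c * ((s ! : ℝ) / r ^ s * E s) * Real.exp (b * r) :=
        mul_le_mul_of_nonneg_left (Real.sum_le_exp_of_nonneg (by positivity) _) (mul_nonneg hc hX0)
    _ = (s ! : ℝ) / r ^ (s + 1) * (E s * y) := by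
        rw [hy, pow_succ]
        field_simp
    _ ≤ (s ! : ℝ) / r ^ (s + 1) * (((s : ℝ) + 1) * E (s + 1)) :=
        mul_le_mul_of_nonneg_left hEy (by positivity)
    _ = ((s + 1)! : ℝ) / r ^ (s + 1) * E (s + 1) := by
        rw [Nat.factorial_succ, Nat.cast_mul]
        push_cast
        ring

/-- **Summing the majorant against binomial weights**: for `x ≥ 0`, `y ≥ 0`, `r > 0`,
`Σ_{t≤m} C(m,t) x^{m−t} · (t! r^{−t} Σ_{j≤t} y^j/j!) ≤ m!·r^{−m}·e^{xr}·e^{y}`. -/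
theorem touchard_total (x y r : ℝ) (hx : 0 ≤ x) (hy : 0 ≤ y) (hr : 0 < r) (m : ℕ) :
    ∑ t ∈ range (m + 1), (m.choose t : ℝ) * x ^ (m - t) *
        ((t ! : ℝ) / r ^ t * ∑ j ∈ range (t + 1), y ^ j / (j ! : ℝ)) ≤
      (m ! : ℝ) / r ^ m * Real.exp (x * r) * Real.exp y := by
  have hterm : ∀ t ∈ range (m + 1), (m.choose t : ℝ) * x ^ (m - t) *
      ((t ! : ℝ) / r ^ t * ∑ j ∈ range (t + 1), y ^ j / (j ! : ℝ)) ≤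
      (m ! : ℝ) / r ^ m * ((x * r) ^ (m - t) / ((m - t)! : ℝ)) * Real.exp y := by
    intro t ht
    have htm : t ≤ m := Nat.lt_succ_iff.mp (mem_range.mp ht)
    have hchoose : (m.choose t : ℝ) * (t ! : ℝ) = (m ! : ℝ) / ((m - t)! : ℝ) := by
      rw [eq_div_iff (by exact_mod_cast (Nat.factorial_pos (m - t)).ne')]
      have := Nat.choose_mul_factorial_mul_factorial htm
      exact_mod_cast this
    have hrpow : r ^ (m - t) * r ^ t = r ^ m := pow_sub_mul_pow r htm
    calc (m.choose t : ℝ) * x ^ (m - t) * ((t ! : ℝ) / r ^ t * ∑ j ∈ range (t + 1), y ^ j / (j ! : ℝ))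
        = (m.choose t : ℝ) * (t ! : ℝ) * x ^ (m - t) / r ^ t * ∑ j ∈ range (t + 1), y ^ j / (j ! : ℝ) := by
          ring
      _ ≤ (m.choose t : ℝ) * (t ! : ℝ) * x ^ (m - t) / r ^ t * Real.exp y := by
          gcongr
          exact Real.sum_le_exp_of_nonneg hy _
      _ = (m ! : ℝ) / r ^ m * ((x * r) ^ (m - t) / ((m - t)! : ℝ)) * Real.exp y := by
          rw [hchoose, mul_pow, ← hrpow]
          field_simp
  calc ∑ t ∈ range (m + 1), (m.choose t : ℝ) * x ^ (m - t) *
        ((t ! : ℝ) / r ^ t * ∑ j ∈ range (t + 1), y ^ j / (j ! : ℝ))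
      ≤ ∑ t ∈ range (m + 1), (m ! : ℝ) / r ^ m * ((x * r) ^ (m - t) / ((m - t)! : ℝ)) * Real.exp y :=
        Finset.sum_le_sum hterm
    _ = (m ! : ℝ) / r ^ m * (∑ t ∈ range (m + 1), (x * r) ^ (m - t) / ((m - t)! : ℝ)) * Real.exp y := by
        rw [Finset.mul_sum, Finset.sum_mul]
    _ = (m ! : ℝ) / r ^ m * (∑ t ∈ range (m + 1), (x * r) ^ t / (t ! : ℝ)) * Real.exp y := by
        rw [← Finset.sum_range_reflect (fun t => (x * r) ^ t / (t ! : ℝ)) (m + 1)]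
        simp only [Nat.add_sub_cancel]
    _ ≤ (m ! : ℝ) / r ^ m * Real.exp (x * r) * Real.exp y := by
        gcongr
        exact Real.sum_le_exp_of_nonneg (by positivity) _

end Touchard

end

end Summit.HubbardSuperconductivity.HubbardSuperconductivity.Theorems.MatsubaraAllU
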